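import Mathlib
import HarnessLib
import Summits.Langlands.Langlands.Theses.EisensteinGelfandKirillov
import Literature.NumberTheory.Automorphic.ResGLnCohomology

/-!
# Route `EisensteinGelfandKirillov`, crux `CrystallineProModularClassical` (stmt-Langlands-18274):
# vocabulary of the line `torsion-weight-exchange`

Route-posited objects (D-0016 `<Route><Crux>Defs`-type file; same convention as
`EisensteinGelfandKirillovProModularOfGKBoundDefs.lean`) shared by the registered stubs of the checked
skeleton `Cruxes/CrystallineProModularClassical/Lines/torsion_weight_exchange.lean` (planner rev 1,
planner-cruxplan-stmt-Langlands-18274-torsion-weight-excha-0, 2026-08-17; lead copy registered by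
`ledger skeleton check`, stubs `stub_tameLevelStripping`, `stub_weightExchange`, `stub_exactOccupancy`,
`stub_eichlerShimuraHarder`) and by the crux file that composes them.  NOTHING IS ASSERTED: every
`def … : Prop` below is a *statement* (a line predicate with parameters) consumed only inside the
types of stub theorems; the theorems of §0′ are proved glue / sanity lemmas (no `sorry`, standard
axioms).  Declared in the skeleton's namespace
`Summit.Langlands.Langlands.Cruxes.CrystallineProModularClassical.TorsionWeightExchange`, so that a
landed stub `theorem stub_<name> : <registered signature>` reads byte-identically to its registration
(the lead's skeleton imports this file in place of its inline copies).

**The line in one paragraph** (line card `Lines/torsion-weight-exchange.md`).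
`TameLevel.IsPadicallyAutomorphic ρ` is a CONTINUOUS `ℚ̄_p`-point `x` of the big Hecke algebra
`𝕋(K^p) ⊂ ∏_{(r,s,i)} End(H^i(X_{U_r}, ℤ/p^s))` (product of DISCRETE rings); continuity says exactly
that `x mod p^s` factors through a FINITE level of the tower for every `s`
(`finiteLevelFactorization`, proved here), and "`x` is classical of weight `λ`, level `𝔫`" is
EQUALLY a tower statement (`x mod p^s` factors through the Hecke algebra of the finite-dimensional
receptacle `H^q(S_{K_f(𝔫)}, Ẽ_λ(ℚ̄_p)) = ResGLnCohomology.levelCohomology …` for every `s`).  All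
statements are LATTICE-FREE ("relation currency"): "`x mod p^s` factors through the Hecke algebra
of `M`" means that every INTEGRAL non-commutative polynomial relation among the good `T_{v,i}` on
`M` holds for the values `x(T_{v,i})` up to `p^{-s}` (Mathlib `FreeAlgebra.lift`,
`FreeAlgebra.equivMonoidAlgebraFreeMonoid`, `MonoidAlgebra.coeff`).

Objects: `FactorsThroughFiniteLevelModP`, `IsIntegralPoly`, `FactorsThroughClassicalModP`,
`FactorsThroughWeightModP` (`C_s`), `IsClassicalOfWeight`; glue: `finiteLevelFactorization` (S1 of
the card: continuity ⇒ finite-level factorisation), `factorsThroughWeightModP_mono`,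
`lift_apply_eigenvector`, `factorsThroughWeightModP_of_isClassicalOfWeight` (classical points
satisfy `C_s` for all `s`), `isIntegralPoly_one`, `not_factorsThroughClassicalModP_empty` (the empty
family never carries `x mod p^s`, `s ≥ 1`).
-/

set_option linter.dupNamespace false
set_option autoImplicit false

namespace Summit.Langlands.Langlands.Cruxes.CrystallineProModularClassical.TorsionWeightExchange

open Summit.Langlands.Langlands.Theses.EisensteinGelfandKirillov
open Literature.NumberTheory.Automorphic Literature.NumberTheory.GaloisRepresentations
open Literature.NumberTheory.Automorphic.BigHeckeGLn
open NumberField IsDedekindDomain Filter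
open scoped Classical

noncomputable section

variable {F : Type} [Field F] [NumberField F] {p : ℕ} [Fact p.Prime]

/-! ## 0. Vocabulary of the line (definitions with bodies — line predicates, not vendored facts) -/

/-- **`x mod p^s` factors through a FINITE level of the tower.** There is a finite set `J` of indices
`(r, s', i)` such that every `t ∈ 𝕋(K^p)` whose components `t_{(r,s',i)} ∈ End(H^i(X_{U_r}, ℤ/p^{s'}))` vanish
for all `(r,s',i) ∈ J` has `‖x t‖ ≤ p^{-s}`; i.e. `x mod p^s` is a well-defined character of the finite-level
Hecke algebra `im(𝕋(K^p) → ∏_{J} End(H^i(X_{U_r}, ℤ/p^{s'})))`. This is ALL that the continuity of a pro-modular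
point gives (`finiteLevelFactorization`), and all the line consumes of it. -/
def FactorsThroughFiniteLevelModP (𝒰 : TameLevel 2 F p)
    (x : CompletedCohomologyHeckeAlgebraGLn 𝒰 →+* PadicAlgCl p) (s : ℕ) : Prop :=
  ∃ J : Finset (ℕ × ℕ × ℕ), ∀ t : CompletedCohomologyHeckeAlgebraGLn 𝒰,
    (∀ j ∈ J, (t : 𝒰.bigEnd) j = 0) → ‖x t‖ ≤ ((p : ℝ)⁻¹) ^ s

/-- A non-commutative polynomial over `ℚ̄_p` in `r` letters is INTEGRAL: all its coefficients (in the
monoid-algebra model `ℚ̄_p[FreeMonoid (Fin r)]`, Mathlib `FreeAlgebra.equivMonoidAlgebraFreeMonoid`) have norm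
`≤ 1`. [folklore] -/
def IsIntegralPoly {r : ℕ} (P : FreeAlgebra (PadicAlgCl p) (Fin r)) : Prop :=
  ∀ w, ‖(FreeAlgebra.equivMonoidAlgebraFreeMonoid P).coeff w‖ ≤ 1

/-- **`x mod p^s` factors JOINTLY through the Hecke algebra of a finite family of CLASSICAL receptacles**
`H^{q_k}(S_{K_f(𝔫)}, Ẽ_{λ_k}(ℚ̄_p))` (`ResGLnCohomology.levelCohomology`: Betti cohomology of the adelic locally
symmetric space of `Res_{F/ℚ} GL₂` of level `K_f(𝔫)`, coefficients in the algebraic local system of weight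
`λ_k`), `k < m`, in relation currency: every integral non-commutative polynomial relation satisfied by the good
Hecke operators `T_{v,i}` (`v ∉ S = 𝒰.bad`, `v ∤ 𝔫`) on EVERY member of the family is satisfied by the values
`x(T_{v,i})` up to `p^{-s}`. (The empty family and families of zero modules make this FALSE through `P = 1`.) -/
def FactorsThroughClassicalModP (𝒰 : TameLevel 2 F p)
    (x : CompletedCohomologyHeckeAlgebraGLn 𝒰 →+* PadicAlgCl p) (𝔫 : Ideal (𝓞 F))
    {m : ℕ} (lams : Fin m → (F →+* PadicAlgCl p) → Fin 2 → ℤ) (qs : Fin m → ℕ) (s : ℕ) : Prop :=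
  ∀ (r : ℕ) (ix : Fin r → HeightOneSpectrum (𝓞 F) × ℕ),
    (∀ j, (ix j).1 ∉ 𝒰.bad ∧ ¬ (ix j).1.asIdeal ∣ 𝔫) →
    ∀ P : FreeAlgebra (PadicAlgCl p) (Fin r), IsIntegralPoly P →
      (∀ k : Fin m, FreeAlgebra.lift (PadicAlgCl p)
          (fun j => ResGLnCohomology.heckeT (PadicAlgCl p) 2 F 𝔫 (lams k) (qs k) (ix j).1 (ix j).2) P = 0) →
      ‖FreeAlgebra.lift (PadicAlgCl p) (fun j => x (𝒰.heckeT (ix j).1 (ix j).2)) P‖ ≤ ((p : ℝ)⁻¹) ^ s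

/-- **`C_s`: `x mod p^s` factors through the weight-`λ`, level-`𝔫`, degree-`q` classical Hecke algebra**
(one receptacle `H^q(S_{K_f(𝔫)}, Ẽ_λ(ℚ̄_p))`), relation currency. The torsion-occurrence predicate of the card. -/
def FactorsThroughWeightModP (𝒰 : TameLevel 2 F p)
    (x : CompletedCohomologyHeckeAlgebraGLn 𝒰 →+* PadicAlgCl p) (𝔫 : Ideal (𝓞 F))
    (lam : (F →+* PadicAlgCl p) → Fin 2 → ℤ) (q s : ℕ) : Prop :=
  ∀ (r : ℕ) (ix : Fin r → HeightOneSpectrum (𝓞 F) × ℕ),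
    (∀ j, (ix j).1 ∉ 𝒰.bad ∧ ¬ (ix j).1.asIdeal ∣ 𝔫) →
    ∀ P : FreeAlgebra (PadicAlgCl p) (Fin r), IsIntegralPoly P →
      FreeAlgebra.lift (PadicAlgCl p)
          (fun j => ResGLnCohomology.heckeT (PadicAlgCl p) 2 F 𝔫 lam q (ix j).1 (ix j).2) P = 0 →
      ‖FreeAlgebra.lift (PadicAlgCl p) (fun j => x (𝒰.heckeT (ix j).1 (ix j).2)) P‖ ≤ ((p : ℝ)⁻¹) ^ s

/-- **`x` is CLASSICAL of weight `λ`, level `𝔫`, degree `q`**: a non-zero simultaneous eigenclass in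
`H^q(S_{K_f(𝔫)}, Ẽ_λ(ℚ̄_p))` for the good `T_{v,i}` (`v ∉ S`, `v ∤ 𝔫`, all `i`) with eigenvalues `x(T_{v,i})`. -/
def IsClassicalOfWeight (𝒰 : TameLevel 2 F p)
    (x : CompletedCohomologyHeckeAlgebraGLn 𝒰 →+* PadicAlgCl p) (𝔫 : Ideal (𝓞 F))
    (lam : (F →+* PadicAlgCl p) → Fin 2 → ℤ) (q : ℕ) : Prop :=
  ∃ c : ResGLnCohomology.levelCohomology (PadicAlgCl p) 2 F 𝔫 lam q, c ≠ 0 ∧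
    ∀ v ∉ 𝒰.bad, ¬ v.asIdeal ∣ 𝔫 → ∀ i : ℕ,
      ResGLnCohomology.heckeT (PadicAlgCl p) 2 F 𝔫 lam q v i c = x (𝒰.heckeT v i) • c

/-! ## 0′. Proved glue and sanity lemmas (no `sorry`) -/

/-- **S1 (PROVED): continuity of a point IS finite-level factorisation.** A continuous
`x : 𝕋(K^p) → ℚ̄_p` factors `mod p^s`, for every `s`, through a finite level of the tower: the closed ball of
radius `p^{-s}` is OPEN in the ultrametric `ℚ̄_p` (`IsUltrametricDist.isOpen_closedBall`), its preimage is an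
open neighbourhood of `0` for the subspace topology of the product of the DISCRETE factors
(`isOpen_induced_iff`, `isOpen_pi_iff`), hence contains the kernel of the projection to finitely many factors.
This is the native form in which the line consumes `IsPadicallyAutomorphic` (card S1, first half; triage r2-2
"provable from `bigHeckeSubring`"). [folklore] -/
theorem finiteLevelFactorization (𝒰 : TameLevel 2 F p)
    (x : CompletedCohomologyHeckeAlgebraGLn 𝒰 →+* PadicAlgCl p) (hx : Continuous x) (s : ℕ) :
    FactorsThroughFiniteLevelModP 𝒰 x s := by
  have hp0 : ((p : ℝ)⁻¹) ^ s ≠ 0 :=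
    pow_ne_zero _ (inv_ne_zero (Nat.cast_ne_zero.2 (Fact.out : p.Prime).ne_zero))
  -- `U := x ⁻¹' B̄(0, p^{-s})` is an open neighbourhood of `0` in `𝕋(K^p)` (closed balls are open)
  have hU : IsOpen (x ⁻¹' Metric.closedBall (0 : PadicAlgCl p) (((p : ℝ)⁻¹) ^ s)) :=
    (IsUltrametricDist.isOpen_closedBall (0 : PadicAlgCl p) hp0).preimage hx
  -- subspace topology: `U` is the trace of an open `V` of the product
  obtain ⟨V, hV, hVU⟩ := isOpen_induced_iff.1 hU
  have h0U : (0 : CompletedCohomologyHeckeAlgebraGLn 𝒰) ∈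
      x ⁻¹' Metric.closedBall (0 : PadicAlgCl p) (((p : ℝ)⁻¹) ^ s) := by
    simp [Metric.mem_closedBall]
  have h0V : ((0 : CompletedCohomologyHeckeAlgebraGLn 𝒰) : 𝒰.bigEnd) ∈ V := by
    rw [← hVU] at h0U
    exact h0U
  -- product of discrete factors: `V` contains a cylinder over a finite index set `I` through `0`
  obtain ⟨I, u, hu, hIu⟩ := isOpen_pi_iff.1 hV _ h0V
  refine ⟨I, fun t ht => ?_⟩
  have htV : (t : 𝒰.bigEnd) ∈ V := by
    refine hIu (Set.mem_pi.2 fun j hj => ?_)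
    rw [ht j (Finset.mem_coe.1 hj)]
    have h := (hu j (Finset.mem_coe.1 hj)).2
    simpa using h
  have htU : t ∈ x ⁻¹' Metric.closedBall (0 : PadicAlgCl p) (((p : ℝ)⁻¹) ^ s) := by
    rw [← hVU]
    exact htV
  simpa [Metric.mem_closedBall] using htU

/-- `C_{s'}` implies `C_s` for `s ≤ s'` (`p^{-s'} ≤ p^{-s}`). [folklore] -/
theorem factorsThroughWeightModP_mono {𝒰 : TameLevel 2 F p}
    {x : CompletedCohomologyHeckeAlgebraGLn 𝒰 →+* PadicAlgCl p} {𝔫 : Ideal (𝓞 F)}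
    {lam : (F →+* PadicAlgCl p) → Fin 2 → ℤ} {q s s' : ℕ} (hss' : s ≤ s')
    (h : FactorsThroughWeightModP 𝒰 x 𝔫 lam q s') : FactorsThroughWeightModP 𝒰 x 𝔫 lam q s := by
  intro r ix hix P hP hrel
  refine (h r ix hix P hP hrel).trans ?_
  apply pow_le_pow_of_le_one (by positivity)
  · exact inv_le_one_of_one_le₀ (by exact_mod_cast (Fact.out : p.Prime).one_le)
  · exact hss'

/-- A non-commutative polynomial in operators, applied to a simultaneous eigenvector, acts by the same
polynomial in the eigenvalues (`FreeAlgebra.induction`). [folklore] -/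
theorem lift_apply_eigenvector {k : Type} [Field k] {V : Type} [AddCommGroup V] [Module k V]
    {r : ℕ} (T : Fin r → Module.End k V) (a : Fin r → k) (c : V) (hc : ∀ j, T j c = a j • c)
    (P : FreeAlgebra k (Fin r)) :
    FreeAlgebra.lift k T P c = FreeAlgebra.lift k a P • c := by
  induction P using FreeAlgebra.induction with
  | grade0 r =>
    simp [Algebra.algebraMap_eq_smul_one]
  | grade1 j =>
    simpa using hc j
  | add P Q hP hQ =>
    simp [map_add, hP, hQ, add_smul]
  | mul P Q hP hQ =>
    rw [map_mul, map_mul, Module.End.mul_apply, hQ, map_smul, hP, smul_smul, mul_comm]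

/-- **Sanity (non-vacuity in kind): a CLASSICAL point satisfies `C_s` at every precision** — every relation
among the `T_{v,i}` on the receptacle kills the eigenclass, hence vanishes EXACTLY on the eigenvalues. So the
hypothesis of `stub_exactOccupancy` / the conclusion of `stub_weightExchange` is satisfied by the points it is
meant to describe. [folklore] -/
theorem factorsThroughWeightModP_of_isClassicalOfWeight {𝒰 : TameLevel 2 F p}
    {x : CompletedCohomologyHeckeAlgebraGLn 𝒰 →+* PadicAlgCl p} {𝔫 : Ideal (𝓞 F)}
    {lam : (F →+* PadicAlgCl p) → Fin 2 → ℤ} {q : ℕ} (h : IsClassicalOfWeight 𝒰 x 𝔫 lam q) (s : ℕ) :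
    FactorsThroughWeightModP 𝒰 x 𝔫 lam q s := by
  obtain ⟨c, hc, heig⟩ := h
  intro r ix hix P hP hrel
  have key := lift_apply_eigenvector
    (fun j => ResGLnCohomology.heckeT (PadicAlgCl p) 2 F 𝔫 lam q (ix j).1 (ix j).2)
    (fun j => x (𝒰.heckeT (ix j).1 (ix j).2)) c (fun j => heig _ (hix j).1 (hix j).2 _) P
  rw [hrel, LinearMap.zero_apply] at key
  have h0 : FreeAlgebra.lift (PadicAlgCl p) (fun j => x (𝒰.heckeT (ix j).1 (ix j).2)) P = 0 := by
    by_contra hne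
    exact hc ((smul_eq_zero.1 key.symm).resolve_left hne)
  rw [h0, norm_zero]
  positivity

/-- `1` is an integral polynomial. [folklore] -/
theorem isIntegralPoly_one {r : ℕ} : IsIntegralPoly (p := p) (1 : FreeAlgebra (PadicAlgCl p) (Fin r)) := by
  intro w
  classical
  rw [map_one, MonoidAlgebra.one_def, MonoidAlgebra.coeff_single, Finsupp.single_apply]
  split_ifs <;> simp

/-- **Sanity (non-vacuity of the hypothesis side): the EMPTY family never carries an eigensystem `mod p^s`,
`s ≥ 1`** — `P = 1` is a relation on every member of the empty family and `‖x(1)‖ = 1 > p^{-s}`. So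
`FactorsThroughClassicalModP` is never vacuously true, and `stub_tameLevelStripping` must produce receptacles. -/
theorem not_factorsThroughClassicalModP_empty (𝒰 : TameLevel 2 F p)
    (x : CompletedCohomologyHeckeAlgebraGLn 𝒰 →+* PadicAlgCl p) (𝔫 : Ideal (𝓞 F))
    (lams : Fin 0 → (F →+* PadicAlgCl p) → Fin 2 → ℤ) (qs : Fin 0 → ℕ) {s : ℕ} (hs : s ≠ 0) :
    ¬ FactorsThroughClassicalModP 𝒰 x 𝔫 lams qs s := by
  intro h
  have h1 := h 0 Fin.elim0 (fun j => Fin.elim0 j) 1 isIntegralPoly_one (fun k => Fin.elim0 k)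
  rw [map_one, norm_one] at h1
  have hlt : ((p : ℝ)⁻¹) ^ s < 1 :=
    pow_lt_one₀ (by positivity)
      (inv_lt_one_of_one_lt₀ (by exact_mod_cast (Fact.out : p.Prime).one_lt)) hs
  exact absurd h1 (not_le.2 hlt)

end

end Summit.Langlands.Langlands.Cruxes.CrystallineProModularClassical.TorsionWeightExchange
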